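import Literature.NumberTheory.EllipticCurves.HeegnerPointsKolyvaginPairingCM
import HarnessLib

/-!
# The Galois element behind the Čebotarev choice — semilinear (CM, `p = 2`) form

Sequel of `HeegnerPointsKolyvaginPairingCM` (Gross 1991, Props. 9.1/9.3 for an action of `Γ_K` on
`E[n]` through commuting operators) and the CM / `p = 2` counterpart of
`IsLiftOfAut.exists_h1Eval_conj_mul_eq_zero_iff` (`HeegnerPointsKolyvaginPairing`; McCallum 1991,
Prop. 3.1 / Cor. 3.2: the element `ρ` with `[x_i, (τρm)²] = 0 ⟺ N_i = 0`), which needs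
eigenvectors `e₊, e₋` of both signs for the lift `τ` of complex conjugation and `2` invertible on
`E[p]`. Over the CM field at `p = 2` the substitute (cell memo MEMO-bsd-cm-two §57.4, Steps 3–4)
is the unramified quadratic descent `𝔽₄/𝔽₂`: classes FIXED by `σ` span everything over
`(ℤ/2)[ω]`, `(1 + τ)` maps `E[2] ≅ 𝔽₄` onto its `τ`-fixed line `𝔽₂·e₀` (trace surjectivity),
and for `s = s₀ + ω s₁` one gets `[s, (τρm)²] = φ(s₀)·e₀ + φ(s₁)·ω e₀`. Proved here, generically
(any field tower `K/k`, any `σ ∈ Aut(K/k)` with an involutive lift `τ`, any Weierstrass curve over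
`k`, any prime level `p`; the CM features are explicit hypotheses — an additive `w` on `E[p]` with
`w³ = 1`, an operator `wH` on `H¹(K, E[p])` over it, and the semilinearity relations
`σ_*(wH x) = wH (wH (σ_* x))`, `τ (w P) = w (w (τ P))` of the tree's
`JZero.exists_cm_operator_galH1Torsion`):

* `IsLiftOfAut.h1Eval_conjGalCMH` — `[x, τ⁻¹ρτ] = τ [σ_* x, ρ]` for ANY class `x` (the tree records
  the eigenclass case `h1Eval_conjGalCMH_of_eigen`).
* `IsLiftOfAut.exists_h1Eval_conj_mul_eq_of_comm` — for `σ`-FIXED classes `x₁, …, x_r`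
  independent over `(ℤ/p)[w]`, targets `N_i ∈ {0, 1}` and a point `e′ ∈ E[p]`: there is
  `ρ ∈ Γ_{K(E[p])}` such that for every `m ∈ 𝒩` and `F = (τ⁻¹(ρm)τ)(ρm)`:
  `[x_i, F] = N_i • e₀` and `[wH x_i, F] = N_i • w e₀`, `e₀ := τe′ + e′`.
* `IsLiftOfAut.h1Eval_conj_mul_sum_eq_of_comm` — hence on the `(ℤ/p)[w]`-span:
  `[∑ (a_i x_i + b_i wH x_i), F] = (∑ N_i a_i) • e₀ + (∑ N_i b_i) • w e₀` — the realizable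
  vanishing patterns of memo Step 4 (zero iff both coefficient sums vanish mod `p`, once the
  consumer knows `e₀` and `w e₀` independent: `e₀ ≠ 0`, `w` fixed-point-free).

This is the single-curve input «THE ρ» for the tree's `exists_kolyvaginPrime_gt_of_galoisElement`
(`HeegnerPointsKolyvaginPrimaryCebotarevFrobeniusProofs`, any `p`) and for the announced pair
version (bsd-cm-k7t-c3x); the two-curve joint choice of `ρ` (linear disjointness of `L_{A,S}` and
`L_{B,S′}` over `K`) is NOT here. Leaf (L3) of
`Summits/…/SylvesterTwoHeegnerIndexCoupledDescentAtTwo.lean`.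

## References

* W. G. McCallum, *Kolyvagin's work on Shafarevich–Tate groups*, LMS LN 153 (1991), §3,
  Prop. 3.1 and Cor. 3.2 (proofs). [McCallumLMS1991]
* B. H. Gross, *Kolyvagin's work on modular elliptic curves*, ibid., §9. [GrossLMS1991]
* Cell memo MEMO-bsd-cm-two §57.4, Steps 3–4.
-/

noncomputable section

open scoped Classical
open WeierstrassCurve
open Literature.NumberTheory.GaloisRepresentations

universe u v

namespace Literature.NumberTheory.EllipticCurves

section ConjComm

variable {k : Type v} {K : Type u} [Field k] [Field K] [Algebra k K] (W : WeierstrassCurve k)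
variable {σ : K ≃ₐ[k] K} {τ : AlgebraicClosure K ≃+* AlgebraicClosure K}

/-- **`[x, τ⁻¹ρτ] = τ [σ_* x, ρ]`** for an involutive lift `τ` of `σ`, any class `x ∈ H¹(K, E[n])`
and `ρ ∈ Γ_{K(E[n])}` (from the tree's `h1Eval_conjAct`: `[σ_* x, ρ] = τ [x, τ⁻¹ρτ]`, and
`τ² = 1`). [cite: GrossLMS1991, §9 (pairing after Prop. 9.1)] -/
theorem IsLiftOfAut.h1Eval_conjGalCMH (hτ : IsLiftOfAut σ τ) (hinv : ∀ x, τ (τ x) = x) (n : ℤ)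
    (x : galH1Torsion (W.baseChange K) n) {ρ : Field.absoluteGaloisGroup K}
    (hρ : ρ ∈ torsionFixing (W.baseChange K) n) :
    h1Eval (W.baseChange K) n x (hτ.conjGalCMH ρ) =
      hτ.torsionMap W n (h1Eval (W.baseChange K) n (conjAct W σ n x) ρ) := by
  rw [hτ.h1Eval_conjAct W n x hρ, hτ.torsionMap_torsionMap W hinv]

/-- **The Galois element behind the Čebotarev choice, semilinear form (memo two §57.4 Steps
3–4; McCallum 1991 Prop. 3.1 / Cor. 3.2 at `p = 2` over the CM field).** Data: an involutive lift
`τ` of `σ ∈ Aut(K/k)`; on `E[p]` (over `K̄`) a simple `Γ_K`-module structure with commutant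
`{a + b w}` for an additive `w` with `w³ = 1` (`hS`, `hC`, `hw3`), the action through commuting
operators with some `z - 1` invertible (`hcomm`, `ι`); an operator `wH` on `H¹(K, E[p])` over `w`
(`hwH`) with `σ_* (wH x) = wH (wH (σ_* x))` (`hσw`) and `τ (w P) = w (w (τ P))` (`hτw`); a point
`e′ ∈ E[p]`; `σ`-FIXED classes `x_i` with no relation `∑ (a_i x_i + b_i wH x_i) = 0` except
`p ∣ a_i, b_i`; targets `N_i : ℕ` (meant in `{0, 1}`). CONCLUSION: some `ρ ∈ Γ_{K(E[p])}` has, for every `m ∈ 𝒩(x)`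
and `F := (τ⁻¹(ρm)τ)·(ρm)` (the square of `τρm`), `[x_i, F] = N_i • (τe′ + e′)` and
`[wH x_i, F] = N_i • w(τe′ + e′)`. Proof: choose `[x_i, ρ] = N_i • e′`
(`exists_h1Eval_eq_of_comm`); then `[x_i, F] = τ[σ_* x_i, ρm] + [x_i, ρm] = (1 + τ)(N_i e′)`, and
`[wH x_i, F] = τ[wH wH x_i, ρm] + w[x_i, ρm] = τ(w²(N_i e′)) + w(N_i e′) = w (1+τ)(N_i e′)` by the
two semilinearity relations and `w³ = 1`. [cite: McCallumLMS1991, Prop. 3.1 and Cor. 3.2 (proofs)] -/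
theorem IsLiftOfAut.exists_h1Eval_conj_mul_eq_of_comm (hτ : IsLiftOfAut σ τ)
    (hinv : ∀ x, τ (τ x) = x) {p : ℕ} (hp : p.Prime)
    (hS : ∀ H : AddSubgroup (geomTorsion (W.baseChange K) p),
      (∀ g : Field.absoluteGaloisGroup K, ∀ t ∈ H, g • t ∈ H) → H = ⊥ ∨ H = ⊤)
    (w : geomTorsion (W.baseChange K) p →+ geomTorsion (W.baseChange K) p)
    (hw3 : ∀ P, w (w (w P)) = P)
    (hC : ∀ f : geomTorsion (W.baseChange K) p →+ geomTorsion (W.baseChange K) p,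
      (∀ (g : Field.absoluteGaloisGroup K) (t : geomTorsion (W.baseChange K) p),
        f (g • t) = g • f t) → ∃ a b : ℤ, ∀ t, f t = a • t + b • w t)
    (hcomm : ∀ (g h : Field.absoluteGaloisGroup K) (P : geomTorsion (W.baseChange K) p),
      g • h • P = h • g • P)
    {z : Field.absoluteGaloisGroup K}
    (ι : geomTorsion (W.baseChange K) p →+ geomTorsion (W.baseChange K) p)
    (hι : ∀ P, ι (z • P - P) = P)
    (hιg : ∀ (g : Field.absoluteGaloisGroup K) (P : geomTorsion (W.baseChange K) p),
      ι (g • P) = g • ι P)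
    (wH : galH1Torsion (W.baseChange K) p →+ galH1Torsion (W.baseChange K) p)
    (hwH : ∀ x, ∀ ρ ∈ torsionFixing (W.baseChange K) p,
      h1Eval (W.baseChange K) p (wH x) ρ = w (h1Eval (W.baseChange K) p x ρ))
    (hσw : ∀ x, conjAct W σ p (wH x) = wH (wH (conjAct W σ p x)))
    (hτw : ∀ P, hτ.torsionMap W p (w P) = w (w (hτ.torsionMap W p P)))
    (e' : geomTorsion (W.baseChange K) p)
    {r : ℕ} {xs : Fin r → galH1Torsion (W.baseChange K) p}
    (hxs : ∀ i, conjAct W σ p (xs i) = xs i) (Nv : Fin r → ℕ)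
    (hind : ∀ a b : Fin r → ℤ, ∑ i, (a i • xs i + b i • wH (xs i)) = 0 →
      ∀ i, (p : ℤ) ∣ a i ∧ (p : ℤ) ∣ b i) :
    ∃ ρ ∈ torsionFixing (W.baseChange K) p, ∀ m ∈ evalKer (W.baseChange K) p xs, ∀ i,
      h1Eval (W.baseChange K) p (xs i) (hτ.conjGalCMH (ρ * m) * (ρ * m)) =
          Nv i • (hτ.torsionMap W p e' + e') ∧
        h1Eval (W.baseChange K) p (wH (xs i)) (hτ.conjGalCMH (ρ * m) * (ρ * m)) =
          Nv i • w (hτ.torsionMap W p e' + e') := by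
  -- target values `[x_i, ρ] = N_i • e'`
  set e : Fin r → geomTorsion (W.baseChange K) p := fun i ↦ Nv i • e' with he
  obtain ⟨ρ, hρ, hρe⟩ :=
    exists_h1Eval_eq_of_comm (W.baseChange K) hp hS w hC hcomm ι hι hιg wH hwH xs hind e
  refine ⟨ρ, hρ, fun m hm i ↦ ?_⟩
  have hρm : ρ * m ∈ torsionFixing (W.baseChange K) p := mul_mem hρ hm.1
  have hρm' := hτ.conjGalCMH_mem_torsionFixing W hinv _ hρm
  -- `[x_i, ρm] = N_i • e'` (and `[wH x_i, ρm] = N_i • w e'` by `hwH`)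
  have hx : h1Eval (W.baseChange K) p (xs i) (ρ * m) = Nv i • e' := by
    rw [h1Eval_mul _ _ _ hρ, hρe i, hm.2 i, add_zero]
  -- `τ (w (w Q)) = w (τ Q)` from `τ w = w² τ` and `w³ = 1`
  have hτww : ∀ Q, hτ.torsionMap W p (w (w Q)) = w (hτ.torsionMap W p Q) := fun Q ↦ by
    rw [hτw, hτw, hw3]
  constructor
  · rw [h1Eval_mul _ _ _ hρm', hτ.h1Eval_conjGalCMH W hinv _ _ hρm, hxs i, hx, map_nsmul,
      smul_add, add_comm]
  · rw [h1Eval_mul _ _ _ hρm', hτ.h1Eval_conjGalCMH W hinv _ _ hρm, hσw, hxs i, hwH _ _ hρm,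
      hwH _ _ hρm, hx]
    simp only [map_nsmul]
    rw [hτww, map_add, smul_add]

/-- **The realizable vanishing patterns on the `(ℤ/p)[w]`-span (memo two §57.4 Step 4).** With
`ρ`, `m`, `F = (τ⁻¹(ρm)τ)(ρm)` as in `exists_h1Eval_conj_mul_eq_of_comm` (its two conclusions
taken as hypotheses `hxF`, `hwF`), every class `s = ∑ (a_i • x_i + b_i • wH x_i)` has
`[s, F] = (∑ N_i a_i) • e₀ + (∑ N_i b_i) • w e₀`, `e₀ = τe′ + e′` — so `[s, F] = 0` iff both sums
vanish modulo `p`, as soon as `e₀` and `w e₀` are independent (`e₀ ≠ 0`, `w` without non-zero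
fixed point: for `E[2] ≅ 𝔽₄`, `(1+τ)e′ = e₀` spans the `τ`-fixed line and `ω e₀ ∉ 𝔽₂ e₀`).
[cite: McCallumLMS1991, Prop. 3.1 (proof)] -/
theorem h1Eval_conj_mul_sum_eq_of_comm {p : ℕ}
    (w : geomTorsion (W.baseChange K) p →+ geomTorsion (W.baseChange K) p)
    (wH : galH1Torsion (W.baseChange K) p →+ galH1Torsion (W.baseChange K) p)
    {e₀ : geomTorsion (W.baseChange K) p} {r : ℕ} {xs : Fin r → galH1Torsion (W.baseChange K) p}
    (Nv : Fin r → ℕ) {F : Field.absoluteGaloisGroup K}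
    (hF : F ∈ torsionFixing (W.baseChange K) p)
    (hxF : ∀ i, h1Eval (W.baseChange K) p (xs i) F = Nv i • e₀)
    (hwF : ∀ i, h1Eval (W.baseChange K) p (wH (xs i)) F = Nv i • w e₀) (a b : Fin r → ℤ) :
    h1Eval (W.baseChange K) p (∑ i, (a i • xs i + b i • wH (xs i))) F =
      (∑ i, (Nv i : ℤ) * a i) • e₀ + (∑ i, (Nv i : ℤ) * b i) • w e₀ := by
  rw [h1Eval_sum _ _ _ _ hF]
  simp only [h1Eval_add _ _ _ _ hF, h1Eval_zsmul _ _ _ _ hF, hxF, hwF]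
  rw [Finset.sum_smul, Finset.sum_smul, ← Finset.sum_add_distrib]
  refine Finset.sum_congr rfl fun i _ ↦ ?_
  rw [mul_comm (Nv i : ℤ) (a i), mul_comm (Nv i : ℤ) (b i), mul_zsmul, mul_zsmul,
    natCast_zsmul, natCast_zsmul]

end ConjComm

end Literature.NumberTheory.EllipticCurves

end
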